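import Literature.AnabelianGeometry.EtaleTheta.SettingModel
import Literature.AnabelianGeometry.AbsoluteAnabelian.MLFAbsoluteGaloisGroupInfinite

/-!
# The root model of the [EtTh] §1 setting: its augmentation `Π^tp_X → G_{ℚ_p}` is NOT an open map (kernel certificate for GAP row G-L2t11-3)

Mochizuki, *The étale theta function …*, Publ. RIMS **45** (2009), Def. 2.13 (i) p.273 (PDF p.47): the image of
`K^×` in `Out(Π^tp_Y[μ_N])` is formed through the CONTINUOUS cohomology `H¹(G_K, μ_N) → H¹(Π^tp_Y, μ_N)`; [SemiAnbd]
Ex. 3.10 p.43: "natural exact sequence `1 → π₁^temp(X_K̄) → π₁^temp(X_K) → G_K → 1`" of tempered topological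
groups [cite: MochizukiEtTh2009, Def 2.13 (i) p.273 (PDF p.47)].  Layer L2 of the abc-iut cell, seat
abc-iut-L2-t11 (gen 3); PROOF-ONLY, 0 defs.

GAP-LEDGER row G-L2t11-3 asks for the interface-level input «the augmentation `Π^tp_X → G_K` of the tempered
fundamental group is an OPEN map» (equivalently: `G_K` carries the quotient topology), which is what makes
abc-iut-L2-t2's `ThetaEnvData.kummerOut` (Def. 2.13 (i): shifts by cocycles `δ ∘ (Π^tp_Y ↠ G_K)` that are
continuous ON `Π^tp_Y`) no larger than print's image of the continuous `H¹(G_K, μ_N)`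
(`Discharge/Sec2GaloisDictionaryOfSetting.lean`, binder `hopenY`).  This file is the KERNEL CERTIFICATE that the
input is NOT derivable from the `TemperedCurve` / `ThetaSetting` interfaces as typed: at abc-iut-L2-t1's root
model `ThetaSetting.model p` (`SettingModel.lean`: `Π^tp_X := F₂ × G_{ℚ_p}` with the DISCRETE topology, `aug` =
the second projection followed by the identity `G_{ℚ_p}^{disc} → G_{ℚ_p}^{Krull}`) the augmentation is continuous
and onto but NOT open, since `{1}` is open in the discrete `Π^tp_X` while `{1}` is not open in the infinite
compact group `G_{ℚ_p}` (`compactSpace_GQp`, abc-iut-L2-t1; `Padic.infinite_absoluteGaloisGroup`, layer L4).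
So «aug open» is a GENUINE-MODELS-ONLY clause (it fails at the only inhabitant of record, whose tempered topology
is degenerate by design — "Consistency evidence only (degenerate along the tempered topology; not the `π₁` of a
curve)", `SettingModel.lean`), to be supplied with the genuine tempered `π₁` (abc-iut-L3 interface, v-next) — not
a consequence of the present axioms.  HONEST FRAMING: a statement about the synthetic root model only; nothing of
[EtTh]/[SemiAnbd] is asserted; typed ≠ proved; no side is taken on anything downstream ([IUTchIII] Cor. 3.12).
-/

noncomputable section

namespace Literature.AnabelianGeometry.EtaleTheta.SettingModel

open Literature.AnabelianGeometry.SemiGraphs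

variable (p : ℕ) [Fact p.Prime]

/-- `G_{ℚ_p} = Gal(ℚ̄_p/ℚ_p)` is infinite (as the tree's type `SemiGraphs.GQp p`; layer L4's
`Padic.infinite_absoluteGaloisGroup`, Eisenstein polynomials `X^ℓ - p`).  [cite: MochizukiSemiAnbd2006, Ex 3.10 p.43] -/
theorem infinite_GQp : Infinite (GQp p) := Padic.infinite_absoluteGaloisGroup p

/-- `{1}` is not open in `G_{ℚ_p}` for the Krull topology: `G_{ℚ_p}` is compact (abc-iut-L2-t1's `compactSpace_GQp`)
and infinite, hence not discrete.  [cite: MochizukiSemiAnbd2006, Ex 3.10 p.43] -/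
theorem not_isOpen_singleton_one_GQp : ¬ IsOpen ({1} : Set (GQp p)) := by
  intro h
  haveI : DiscreteTopology (GQp p) := discreteTopology_iff_isOpen_singleton_one.mpr h
  haveI : CompactSpace (GQp p) := compactSpace_GQp p
  haveI : Finite (GQp p) := finite_of_compact_of_discrete
  haveI : Infinite (GQp p) := infinite_GQp p
  exact not_finite (GQp p)

/-- **The augmentation `Π^tp_X → G_{ℚ_p}` of the root model `ThetaSetting.model p` is NOT an open map** (it maps
the open set `{1}` of the discrete `Π^tp_X = F₂ × G_{ℚ_p}` onto `{1}`, which is not Krull-open): the interface-level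
input «aug is open» of GAP row G-L2t11-3 is independent of the `TemperedCurve`/`ThetaSetting` axioms — it fails at
their inhabitant of record.  [cite: MochizukiEtTh2009, Def 2.13 (i) p.273 (PDF p.47)] -/
theorem not_isOpenMap_model_aug : ¬ IsOpenMap (ThetaSetting.model p).aug := by
  intro h
  apply not_isOpen_singleton_one_GQp p
  have h1 : ((ThetaSetting.model p).aug : (ThetaSetting.model p).PiTemp → GQp p) '' {1} = {1} := by
    rw [Set.image_singleton, map_one]
  rw [← h1]
  exact h _ (isOpen_discrete _)

/-- The same for the `G_K`-valued augmentation (`K = ℚ_p` at the root, `G_K = (model p).GK ≤ G_{ℚ_p}` with the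
subspace topology — the exact shape of the binder `hopenY`/`hopen` of `Sec2GaloisDictionaryOfSetting.lean` /
`Sec5KummerGaloisDictionary.lean`), for any membership witness `hmem`: not an open map either.
[cite: MochizukiEtTh2009, Def 2.13 (i) p.273 (PDF p.47)] -/
theorem not_isOpenMap_model_aug_codRestrict
    (hmem : ∀ x : (ThetaSetting.model p).PiTemp, (ThetaSetting.model p).aug x ∈ (ThetaSetting.model p).GK) :
    ¬ IsOpenMap fun x : (ThetaSetting.model p).PiTemp =>
      (⟨(ThetaSetting.model p).aug x, hmem x⟩ : (ThetaSetting.model p).GK) := by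
  intro h
  apply not_isOpenMap_model_aug p
  have hval : IsOpenMap (Subtype.val : (ThetaSetting.model p).GK → GQp p) := by
    refine IsOpen.isOpenMap_subtype_val ?_
    -- `G_K = G_{ℚ_p}` at the root (`K = ℚ_p`): the whole group, an open subset
    have htop : ((ThetaSetting.model p).GK : Set (GQp p)) = Set.univ := by
      ext σ
      simp only [SetLike.mem_coe, Set.mem_univ, iff_true]
      exact hmem ((1 : Del), (σ : Gam p))
    rw [htop]
    exact isOpen_univ
  exact hval.comp h

end Literature.AnabelianGeometry.EtaleTheta.SettingModel

end
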